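import Mathlib
import Summits.AnomalousDissipation.AnomalousDissipation.Theses.DyadicWallCascade

/-!
# No half-turn-reversible half-space hierarchy
# (negative lemma for the crux `DyadicWallCascade.HalfSpaceHierarchy`, stmt-AnomalousDissipation-18627)

Refuter file, Negative lane (D-0016), route `DyadicWallCascade` of `Summits/AnomalousDissipation`;
cdisprove seat `refuter-cdisprove-stmt-AnomalousDissipation-18627-0`.

`not_halfTurnReversibleHalfSpaceHierarchy` refutes the census strengthening S⁺₃
(`StrategyCensus.HalfTurnReversibleHierarchy` of `Cruxes/HalfSpaceHierarchy/CensusSignatures.lean`,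
unfolded verbatim): the crux body together with REVERSIBILITY under the half-turn
`R (x, y, z) = (-x, -y, z)`, i.e. `V (R X) = -R (V X)` and `Q (R X) = Q X`.

Mechanism (`setIntegral_unitSq_eq_zero_of_odd_periodic`): on the plane `z = 1` the energy-flux
density `f = V₃ (‖V‖²/2 + Q)` is odd under `q ↦ -q` (because `V₃ ∘ R = -V₃`, `‖V‖ ∘ R = ‖V‖`,
`Q ∘ R = Q`) and `ℤ²`-periodic (band periodicity at height `1`), so
`F = ∫_{[0,1]²} f = -∫_{[0,1]²} f(-q) dq = -∫_{[-1,0]²} f = -∫_{[0,1]²} f = -F`, whence `F = 0`,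
contradicting `F ≠ 0`.  (Fubini to iterated interval integrals, `integral_comp_neg`,
`integral_comp_add_right`.)

Reading for constructions: the energy flux is ODD under every reversing symmetry by a lattice
isometry that preserves the horizontal planes and EVEN under the corresponding plain symmetry, so a
witness of the crux admits no reversing symmetry of this kind.  This excludes the one
non-perturbative existence mechanism for smooth, non-symmetric 3-D steady flows with non-constant
head in print — Lortz's closed-streamline iteration, which needs a reversing reflection to close
the streamlines (D. Lortz, Z. Angew. Math. Phys. 21 (1970) 196–211, doi:10.1007/bf01590644) — in
agreement with census §T2.  Only the flux clauses, periodicity at height `1` and continuity of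
`V, Q` on the plane are used (no Euler equation, no dilation invariance).
-/

open scoped BigOperators Topology InnerProductSpace
open Filter Set MeasureTheory

-- `Summit.<Summit>.<Problem>` is the tree's mandated summit-side namespace (CONVENTIONS §2); for this
-- single-conjunct summit the two coincide, so the duplicate is deliberate.
set_option linter.dupNamespace false

namespace Summit.AnomalousDissipation.AnomalousDissipation.Theorems

namespace HalfSpaceHierarchyNegative

/-- A continuous function on `ℝ²` that is odd under the half-turn `q ↦ -q` and `ℤ²`-periodic has zero
integral over the unit square. [folklore] -/
theorem setIntegral_unitSq_eq_zero_of_odd_periodic (f : ℝ × ℝ → ℝ) (hf : Continuous f)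
    (hodd : ∀ x y : ℝ, f (x, y) = -f (-x, -y))
    (hper1 : ∀ x y : ℝ, f (x + 1, y) = f (x, y)) (hper2 : ∀ x y : ℝ, f (x, y + 1) = f (x, y)) :
    ∫ q in Set.Icc (0:ℝ) 1 ×ˢ Set.Icc (0:ℝ) 1, f q = 0 := by
  have hint : IntegrableOn f (Set.Icc (0:ℝ) 1 ×ˢ Set.Icc (0:ℝ) 1)
      ((volume : Measure ℝ).prod (volume : Measure ℝ)) := by
    rw [← Measure.volume_eq_prod]
    exact hf.continuousOn.integrableOn_compact (isCompact_Icc.prod isCompact_Icc)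
  rw [Measure.volume_eq_prod, setIntegral_prod f hint]
  have inner : ∀ x : ℝ, ∫ y in Set.Icc (0:ℝ) 1, f (x, y) = ∫ y in (0:ℝ)..1, f (x, y) := fun x => by
    rw [intervalIntegral.integral_of_le zero_le_one, integral_Icc_eq_integral_Ioc]
  simp_rw [inner]
  rw [integral_Icc_eq_integral_Ioc, ← intervalIntegral.integral_of_le zero_le_one]
  have h1 : (∫ x in (0:ℝ)..1, ∫ y in (0:ℝ)..1, f (x, y))
      = -∫ x in (0:ℝ)..1, ∫ y in (0:ℝ)..1, f (-x, -y) := by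
    rw [← intervalIntegral.integral_neg]
    congr 1; funext x
    rw [← intervalIntegral.integral_neg]
    congr 1; funext y
    exact hodd x y
  have h2 : ∀ x : ℝ, ∫ y in (0:ℝ)..1, f (-x, -y) = ∫ y in (-1:ℝ)..0, f (-x, y) := by
    intro x
    have := intervalIntegral.integral_comp_neg (a := (0:ℝ)) (b := 1) (fun y => f (-x, y))
    simpa using this
  have h3 : (∫ x in (0:ℝ)..1, ∫ y in (-1:ℝ)..0, f (-x, y)) = ∫ x in (-1:ℝ)..0, ∫ y in (-1:ℝ)..0, f (x, y) := by
    have := intervalIntegral.integral_comp_neg (a := (0:ℝ)) (b := 1) (fun x => ∫ y in (-1:ℝ)..0, f (x, y))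
    simpa using this
  have h4 : ∀ x : ℝ, ∫ y in (-1:ℝ)..0, f (x, y) = ∫ y in (0:ℝ)..1, f (x, y) := by
    intro x
    have := intervalIntegral.integral_comp_add_right (a := (-1:ℝ)) (b := 0) (fun y => f (x, y)) (1:ℝ)
    simp only [neg_add_cancel, zero_add] at this
    rw [← this]
    congr 1; funext y
    exact (hper2 x y).symm
  have h5 : (∫ x in (-1:ℝ)..0, ∫ y in (0:ℝ)..1, f (x, y)) = ∫ x in (0:ℝ)..1, ∫ y in (0:ℝ)..1, f (x, y) := by
    have := intervalIntegral.integral_comp_add_right (a := (-1:ℝ)) (b := 0)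
      (fun x => ∫ y in (0:ℝ)..1, f (x, y)) (1:ℝ)
    simp only [neg_add_cancel, zero_add] at this
    rw [← this]
    congr 1; funext x
    congr 1; funext y
    exact (hper1 x y).symm
  have hchain : (∫ x in (0:ℝ)..1, ∫ y in (0:ℝ)..1, f (-x, -y))
      = ∫ x in (0:ℝ)..1, ∫ y in (0:ℝ)..1, f (x, y) := by
    simp_rw [h2]
    rw [h3]
    simp_rw [h4]
    rw [h5]
  rw [hchain] at h1
  linarith

/-- Continuity of the flux-square parametrisation `q ↦ (q₁, q₂, 1)`. [folklore] -/
theorem continuous_pt : Continuous fun q : ℝ × ℝ => (!₂[q.1, q.2, (1 : ℝ)] : EuclideanSpace ℝ (Fin 3)) := by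
  refine (PiLp.continuous_toLp 2 _).comp ?_
  refine continuous_pi fun i => ?_
  fin_cases i
  · simpa using continuous_fst
  · simpa using continuous_snd
  · simpa using continuous_const

end HalfSpaceHierarchyNegative

open HalfSpaceHierarchyNegative in
/-- **No half-turn-reversible half-space hierarchy** (refutes census strengthening S⁺₃
`HalfTurnReversibleHierarchy` of the crux `DyadicWallCascade.HalfSpaceHierarchy`,
stmt-AnomalousDissipation-18627: the crux body verbatim ∧ `V (R X) = -R (V X)`, `Q (R X) = Q X` for the
half-turn `R (x, y, z) = (-x, -y, z)`).  `R` preserves the plane `z = 1`, maps the unit square to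
`[-1, 0]²` — a translate by the period `(1, 1)` — and `V₃ ∘ R = -V₃`, `‖V‖ ∘ R = ‖V‖`, `Q ∘ R = Q`
on it, so the energy flux satisfies `F = -F`, i.e. `F = 0`.  Reading: `F` is odd under every
REVERSING symmetry (`V ↦ -DS · V ∘ S`) by a lattice isometry preserving the horizontal planes, so
the only non-perturbative existence scheme for smooth non-symmetric 3-D equilibria with non-constant
head — Lortz's closed-line iteration under a reversing reflection (Z. Angew. Math. Phys. 21 (1970),
doi:10.1007/bf01590644) — cannot produce a witness. Only the two flux clauses, band periodicity at
height `1` and continuity on the plane are used. [folklore] -/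
theorem not_halfTurnReversibleHalfSpaceHierarchy :
    ¬ (∃ (V : EuclideanSpace ℝ (Fin 3) → EuclideanSpace ℝ (Fin 3)) (Q : EuclideanSpace ℝ (Fin 3) → ℝ) (C F : ℝ),
        (let H : Set (EuclideanSpace ℝ (Fin 3)) := {X | 0 < X 2}
         let e : Fin 3 → EuclideanSpace ℝ (Fin 3) := fun i => EuclideanSpace.single i (1 : ℝ)
         let pt : ℝ × ℝ → EuclideanSpace ℝ (Fin 3) := fun q => !₂[q.1, q.2, (1 : ℝ)]
         ContDiffOn ℝ ((⊤ : ℕ∞) : WithTop ℕ∞) V H ∧ ContDiffOn ℝ ((⊤ : ℕ∞) : WithTop ℕ∞) Q H ∧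
         (∀ X ∈ H, ‖V X‖ ≤ C ∧ |Q X| ≤ C) ∧ (∀ X ∈ H, ∑ i : Fin 3, (fderiv ℝ V X (e i)) i = 0) ∧
         (∀ X ∈ H, (fderiv ℝ V X) (V X) + gradient Q X = 0) ∧
         (∀ X ∈ H, V ((2 : ℝ) • X) = V X ∧ Q ((2 : ℝ) • X) = Q X) ∧
         (∀ X : EuclideanSpace ℝ (Fin 3), 1 ≤ X 2 → X 2 ≤ 2 →
            V (X + e 0) = V X ∧ V (X + e 1) = V X ∧ Q (X + e 0) = Q X ∧ Q (X + e 1) = Q X) ∧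
         (∫ q in Set.Icc (0 : ℝ) 1 ×ˢ Set.Icc (0 : ℝ) 1, (V (pt q)) 2 = 0) ∧ F ≠ 0 ∧
         (∫ q in Set.Icc (0 : ℝ) 1 ×ˢ Set.Icc (0 : ℝ) 1, (V (pt q)) 2 * (‖V (pt q)‖ ^ 2 / 2 + Q (pt q)) = F)) ∧
        (∀ X : EuclideanSpace ℝ (Fin 3),
          V (!₂[-(X 0), -(X 1), X 2]) = !₂[(V X) 0, (V X) 1, -((V X) 2)] ∧
          Q (!₂[-(X 0), -(X 1), X 2]) = Q X)) := by
  rintro ⟨V, Q, C, F, hbody, hrev⟩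
  simp only at hbody
  obtain ⟨hVs, hQs, _hbdd, _hdiv, _hEul, _hdil, hper, _hmass, hF, hflux⟩ := hbody
  -- continuity of the integrand on the plane `z = 1`
  have hptH : ∀ q : ℝ × ℝ, (!₂[q.1, q.2, (1 : ℝ)] : EuclideanSpace ℝ (Fin 3)) ∈
      {X : EuclideanSpace ℝ (Fin 3) | 0 < X 2} := by intro q; simp
  have hVc : Continuous fun q : ℝ × ℝ => V !₂[q.1, q.2, (1 : ℝ)] :=
    hVs.continuousOn.comp_continuous continuous_pt hptH
  have hQc : Continuous fun q : ℝ × ℝ => Q !₂[q.1, q.2, (1 : ℝ)] :=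
    hQs.continuousOn.comp_continuous continuous_pt hptH
  have hV2c : Continuous fun q : ℝ × ℝ => (V !₂[q.1, q.2, (1 : ℝ)]) 2 :=
    (PiLp.continuous_apply 2 (fun _ : Fin 3 => ℝ) (2 : Fin 3)).comp hVc
  have hfc : Continuous fun q : ℝ × ℝ =>
      (V !₂[q.1, q.2, (1 : ℝ)]) 2 * (‖V !₂[q.1, q.2, (1 : ℝ)]‖ ^ 2 / 2 + Q !₂[q.1, q.2, (1 : ℝ)]) :=
    hV2c.mul ((((hVc.norm).pow 2).div_const 2).add hQc)
  -- the reversing symmetry on the plane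
  have hR : ∀ x y : ℝ, (!₂[-((!₂[-x, -y, (1:ℝ)] : EuclideanSpace ℝ (Fin 3)) 0),
      -((!₂[-x, -y, (1:ℝ)] : EuclideanSpace ℝ (Fin 3)) 1), (!₂[-x, -y, (1:ℝ)] : EuclideanSpace ℝ (Fin 3)) 2]
        : EuclideanSpace ℝ (Fin 3)) = !₂[x, y, (1:ℝ)] := by
    intro x y; ext i; fin_cases i <;> simp
  have hVrev : ∀ x y : ℝ, V !₂[x, y, (1:ℝ)] =
      !₂[(V !₂[-x, -y, (1:ℝ)]) 0, (V !₂[-x, -y, (1:ℝ)]) 1, -((V !₂[-x, -y, (1:ℝ)]) 2)] := by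
    intro x y
    have := (hrev !₂[-x, -y, (1:ℝ)]).1
    rwa [hR x y] at this
  have hQrev : ∀ x y : ℝ, Q !₂[x, y, (1:ℝ)] = Q !₂[-x, -y, (1:ℝ)] := by
    intro x y
    have := (hrev !₂[-x, -y, (1:ℝ)]).2
    rwa [hR x y] at this
  have hV2 : ∀ x y : ℝ, (V !₂[x, y, (1:ℝ)]) 2 = -((V !₂[-x, -y, (1:ℝ)]) 2) := by
    intro x y; rw [hVrev x y]; simp
  have hnorm : ∀ x y : ℝ, ‖V !₂[x, y, (1:ℝ)]‖ = ‖V !₂[-x, -y, (1:ℝ)]‖ := by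
    intro x y; rw [hVrev x y]
    simp only [EuclideanSpace.norm_eq, Fin.sum_univ_three]
    simp
  -- periodicity on the plane
  have he0 : ∀ x y : ℝ, (!₂[x + 1, y, (1:ℝ)] : EuclideanSpace ℝ (Fin 3))
      = !₂[x, y, (1:ℝ)] + EuclideanSpace.single (0 : Fin 3) (1:ℝ) := by
    intro x y; ext i; fin_cases i <;> simp
  have he1 : ∀ x y : ℝ, (!₂[x, y + 1, (1:ℝ)] : EuclideanSpace ℝ (Fin 3))
      = !₂[x, y, (1:ℝ)] + EuclideanSpace.single (1 : Fin 3) (1:ℝ) := by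
    intro x y; ext i; fin_cases i <;> simp
  have hp2 : ∀ x y : ℝ, ((!₂[x, y, (1:ℝ)] : EuclideanSpace ℝ (Fin 3))) 2 = 1 := by intro x y; simp
  have hperV0 : ∀ x y : ℝ, V !₂[x + 1, y, (1:ℝ)] = V !₂[x, y, (1:ℝ)] := fun x y => by
    rw [he0]; exact (hper _ (by rw [hp2]) (by rw [hp2]; norm_num)).1
  have hperV1 : ∀ x y : ℝ, V !₂[x, y + 1, (1:ℝ)] = V !₂[x, y, (1:ℝ)] := fun x y => by
    rw [he1]; exact (hper _ (by rw [hp2]) (by rw [hp2]; norm_num)).2.1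
  have hperQ0 : ∀ x y : ℝ, Q !₂[x + 1, y, (1:ℝ)] = Q !₂[x, y, (1:ℝ)] := fun x y => by
    rw [he0]; exact (hper _ (by rw [hp2]) (by rw [hp2]; norm_num)).2.2.1
  have hperQ1 : ∀ x y : ℝ, Q !₂[x, y + 1, (1:ℝ)] = Q !₂[x, y, (1:ℝ)] := fun x y => by
    rw [he1]; exact (hper _ (by rw [hp2]) (by rw [hp2]; norm_num)).2.2.2
  have hzero := setIntegral_unitSq_eq_zero_of_odd_periodic
    (fun q => (V !₂[q.1, q.2, (1 : ℝ)]) 2 * (‖V !₂[q.1, q.2, (1 : ℝ)]‖ ^ 2 / 2 + Q !₂[q.1, q.2, (1 : ℝ)]))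
    hfc (fun x y => by simp only; rw [hV2 x y, hnorm x y, hQrev x y]; ring)
    (fun x y => by simp only; rw [hperV0, hperQ0]) (fun x y => by simp only; rw [hperV1, hperQ1])
  rw [hzero] at hflux
  exact hF hflux.symm

end Summit.AnomalousDissipation.AnomalousDissipation.Theorems
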